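import Literature.Computability.Complexity.PairPlumbing
import Literature.Computability.Complexity.PairProjections
import Literature.Computability.Complexity.StringEquality
import Literature.Computability.Cryptography.CryptoFoundationsKolmogorov
import Literature.Computability.MetaComplexity.KolmogorovProofs
import HarnessLib

/-!
# Crypto foundations: Kolmogorov-complexity statements — discharged facts

Proofs of the three remaining named facts of
`Literature.Computability.Cryptography.CryptoFoundationsKolmogorov` (**crypto-foundations.S11**
and the sanity lemma `MKtimeP_mem_NP`), kept in a sibling file so that the statement file stays
a definitions/named-facts file and so that it need not import the proof file `KolmogorovProofs`
of the prelude nor the `FinTM2` machine toolkit of `Literature.Computability.Complexity`: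

* `not_computable_kolmogorovComplexity_holds : not_computable_kolmogorovComplexity` —
  Li–Vitányi 3rd ed., Thm 2.3.2 ("The function `C(x)` is not computable"): the statement file
  already reduces it (`not_computable_kolmogorovComplexity_of_isAdditivelyOptimal`, via the
  discharged general form `IsAdditivelyOptimal.not_exists_computable_holds`) to the additive
  optimality of the reference method `univDescription`, which is
  `isAdditivelyOptimal_univDescription_holds` (LV Thm 2.1.1, proved in `KolmogorovProofs`).
* `exists_isAdditivelyOptimal_holds : exists_isAdditivelyOptimal` — LV Thm 2.1.1, existence of
  an additively optimal partial recursive description method: the witness is `univDescription`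
  (this restores the interim proof recorded as a comment in the statement file).
* `MKtimeP_mem_NP_holds : MKtimeP_mem_NP` — `MK^tP[s] ∈ NP` for all polynomials `t, s` and every
  efficient universal machine `U` (Liu–Pass FOCS 2020, §2.2, where `K^t`, `U(Π, 1^t)` and its
  `poly(|Π|, t)` running time are set up; the membership in `NP` is the folklore observation
  "guess the program and run `U`", recorded e.g. by Ko 1991 and Hirahara 2018, §1,
  "MINKT ∈ NP"). The verifier is a genuine polynomial-time `FinTM2` decider assembled from the
  toolkit (`MKtimePNP.verifierLang_mem_P`): the unary-argument plumbing of `PairPlumbing.lean`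
  around the field `UniversalMachine.polyTime`, and the equality test of polynomial-time maps
  `setOf_apply_eq_apply_mem_P` of `StringEquality.lean`; see the section docstring below.

## References

* M. Li, P. Vitányi, *An Introduction to Kolmogorov Complexity and Its Applications*, 3rd ed.,
  Springer 2008, Thm 2.1.1 (invariance theorem), Thm 2.3.2 (`C` is not computable).
  doi:10.1007/978-0-387-49820-1
* M. Li, P. M. B. Vitányi, *Kolmogorov complexity and its applications*, in: J. van Leeuwen
  (ed.), Handbook of Theoretical Computer Science, vol. A, Elsevier 1990, ch. 4: §2, Invariance
  Theorem, p. 198; §2.5, Theorem (Kolmogorov) (a), p. 207 ("`K` is not partial recursive"; same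
  statement and proof as Thm 2.3.2 of the book).
* Y. Liu, R. Pass, *On one-way functions and Kolmogorov complexity*, FOCS 2020, pp. 1243–1254,
  §2.2 (time-bounded Kolmogorov complexity `K^t`, the universal machine `U(Π, 1^t)` with
  polynomial overhead, the languages `MK^tP[s]`). doi:10.1109/FOCS46700.2020.00118,
  arXiv:2009.11514.
* K.-I. Ko, *On the complexity of learning minimum time-bounded Turing machines*, SIAM J.
  Comput. 20 (1991), 962–986 (`MINKT`-type problems are in `NP`). doi:10.1137/0220059
* S. Hirahara, *Non-black-box worst-case to average-case reductions within NP*, FOCS 2018, §1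
  ("MINKT ∈ NP"). doi:10.1109/FOCS.2018.00032
* S. Arora, B. Barak, *Computational Complexity: A Modern Approach*, CUP 2009, Def. 2.1
  (certificate definition of `NP`), §1.3, §3.1 (polynomial-time string and clock computations).
-/

namespace Literature.Computability.Cryptography

open _root_.Computability Complexity Complexity.Classes Complexity.Nondeterministic MetaComplexity

/-- **crypto-foundations.S11**, discharged (Li–Vitányi 3rd ed., Thm 2.3.2, first assertion:
"The function `C(x)` is not computable"): plain Kolmogorov complexity
`C = kolmogorovComplexity : {0,1}* → ℕ` (taken w.r.t. the reference method `univDescription`)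
is not a computable function. Assembled from the general form
`IsAdditivelyOptimal.not_exists_computable_holds` (Thm 2.3.2 for any additively optimal method,
proved in the statement file by the printed diagonal argument) and the invariance theorem
`isAdditivelyOptimal_univDescription_holds` (Thm 2.1.1). [cite: LiVitanyi3rd2008, Thm. 2.3.2] -/
theorem not_computable_kolmogorovComplexity_holds : not_computable_kolmogorovComplexity :=
  not_computable_kolmogorovComplexity_of_isAdditivelyOptimal
    isAdditivelyOptimal_univDescription_holds

/-- **crypto-foundations.S11**, discharged (existence half of the invariance theorem,
Li–Vitányi 3rd ed., Thm 2.1.1: "There is an additively optimal universal partial recursive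
function"): the reference method `univDescription : ⟨n, p⟩ ↦ φₙ(p)` is one
(`isAdditivelyOptimal_univDescription_holds`). [cite: LiVitanyi3rd2008, Thm. 2.1.1] -/
theorem exists_isAdditivelyOptimal_holds : exists_isAdditivelyOptimal :=
  ⟨univDescription, isAdditivelyOptimal_univDescription_holds⟩

/-- Applied form of `not_computable_kolmogorovComplexity_holds`, with the fact unfolded:
`¬ Computable kolmogorovComplexity`. [cite: LiVitanyi3rd2008, Thm. 2.3.2] -/
theorem not_computable_kolmogorovComplexity' : ¬ Computable kolmogorovComplexity :=
  not_computable_kolmogorovComplexity_holds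

/-- The two-sided invariance theorem for plain Kolmogorov complexity against any additively
optimal method `V` (Li–Vitányi 3rd ed., Thm 2.1.1, as printed: `|C(x) − C_V(x)| ≤ c_V`),
i.e. `invariance_theorem` specialised to the reference method now that its additive
optimality is proved. [cite: LiVitanyi3rd2008, Thm. 2.1.1] -/
theorem invariance_theorem_univDescription {V : List Bool →. List Bool}
    (hV : IsAdditivelyOptimal V) : ∃ c : ℕ, ∀ x : List Bool,
      descComplexity univDescription x ≤ descComplexity V x + c ∧
        descComplexity V x ≤ descComplexity univDescription x + c :=
  invariance_theorem isAdditivelyOptimal_univDescription_holds hV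


/-! ### Sanity lemma `MK^tP[s] ∈ NP`, discharged

The printed argument (Liu–Pass 2020, §2.2 with Ko 1991; Hirahara FOCS 2018, §1: "MINKT ∈ NP")
is one line: *guess a program `Π` of length `≤ s(|x|)` and run the universal machine on
`(Π, 1^{t(|x|)})`, which takes time `poly(|Π|, t(|x|))` by the polynomial overhead of `U`
(Liu–Pass 2020, §2.2, p. 8: "`U(Π, 1^t)` can be computed in time `poly(d, t)`"), and accept iff
the output is `x`.* In the tree's certificate calculus (`NP = polyExists P`,
`Nondeterministic.lean`; `P` = languages decided by Mathlib `Turing.FinTM2` machines in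
polynomial time) this becomes: the witness-length polynomial is `s = q`, and the `P`-language of
pairs is the equality test `verifierLang U p = {z | execFn U p z = tagFstFn z}` of the two
polynomial-time string maps

  `execFn U p ⟨x, y⟩ = enc (U.run y (p |x|))` (`enc none = 0`, `enc (some w) = 1 w`)  and
  `tagFstFn ⟨x, y⟩ = 1 x`,

so that `⟨x, y⟩ ∈ verifierLang U p ↔ U.run y (p |x|) = some x` (`boolPair_mem_verifierLang`),
and `verifierLang U p ∈ P` is the toolkit fact "equality tests of `FP` maps are in `P`"
(`setOf_apply_eq_apply_mem_P`, `StringEquality.lean`). The execution map is assembled by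
composition (`PolyTimeComputable.comp_holds`): compute the budget `1^{p |x|}` in front of the
input (`evalHdrFn p`, `UnaryArithMachines.lean`), reshape `1^{|x|} 0 1^{p|x|} 0 ⟨x, y⟩ ↦
⟨1^{p|x|}, y⟩` by the transducer `MKtimePNP.argT`, swap (`swapFn`) to
`⟨y, 1^{p|x|}⟩ = boolPair y (unaryEncodeNat (p |x|))`, which is exactly the input convention of
the field `UniversalMachine.polyTime`, and run `U` as the total string function
`MKtimePNP.runFn U ∈ FP` (`mem_FP_of_unaryArg`, `PairPlumbing.lean`). -/

namespace MKtimePNP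

/-! #### The argument transducer `1ⁿ 0 1ᵃ 0 ⟨x, y⟩ ↦ ⟨1ᵃ, y⟩` -/

/-- States of `argT`: first unary block, budget block (doubled on output), pair reader over
`x` (dropped), copier of `y`, dead. [folklore] -/
inductive ArgSt
  | skip
  | dbl
  | ev
  | od (b : Bool)
  | copy
  | dead
  deriving DecidableEq, Fintype

/-- Transition of `argT`. [folklore] -/
def argStep : ArgSt → Bool → ArgSt × List Bool
  | .skip, true => (.skip, [])
  | .skip, false => (.dbl, [])
  | .dbl, true => (.dbl, [true, true])
  | .dbl, false => (.ev, [false, true])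
  | .ev, b => (.od b, [])
  | .od b, b' => if b' = b then (.ev, []) else if b' = true then (.copy, []) else (.dead, [])
  | .copy, c => (.copy, [c])
  | .dead, _ => (.dead, [])

/-- The argument transducer: on `hdr n a ⟨x, y⟩ = 1ⁿ 0 1ᵃ 0 ⟨x, y⟩` it outputs
`⟨1ᵃ, y⟩ = (1 1)ᵃ 0 1 y` (`argT_eval_hdr`). [folklore] -/
def argT : FST ArgSt Bool Bool where
  init := .skip
  step := argStep
  front := fun _ => []
  keep := fun _ => true

/-- The transition of `argT` (definitional). [folklore] -/
@[simp] theorem argT_step (s : ArgSt) (b : Bool) : argT.step s b = argStep s b := rfl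

/-- The copier of `argT`. [folklore] -/
theorem argT_run_copy (w : List Bool) : (argT.run .copy w).2 = w := by
  induction w with
  | nil => rfl
  | cons b w ih => simp [FST.run_cons, argStep, ih]

/-- The pair reader of `argT` drops `x` and copies `y`. [folklore] -/
theorem argT_run_ev (x y : List Bool) : (argT.run .ev (boolPair x y)).2 = y := by
  induction x with
  | nil => simp [boolPair, FST.run_cons, argStep, argT_run_copy]
  | cons b x ih =>
    rw [StrEq.boolPair_cons_left]
    simpa [FST.run_cons, argStep] using ih

/-- The budget block is doubled and closed by the separator. [folklore] -/
theorem argT_run_dbl (a : ℕ) (x y : List Bool) :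
    (argT.run .dbl (ones a ++ false :: boolPair x y)).2 = boolPair (ones a) y := by
  induction a with
  | zero =>
    rw [show boolPair (ones 0) y = false :: true :: y by simp [boolPair]]
    simp [FST.run_cons, argStep, argT_run_ev]
  | succ a ih =>
    simp only [ones, List.replicate_succ, List.cons_append, FST.run_cons, argT_step, argStep]
      at ih ⊢
    rw [ih, StrEq.boolPair_cons_left]
    rfl

/-- **`argT (1ⁿ 0 1ᵃ 0 ⟨x, y⟩) = ⟨1ᵃ, y⟩`.** [folklore] -/
theorem argT_eval_hdr (n a : ℕ) (x y : List Bool) :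
    argT.eval (hdr n a (boolPair x y)) = boolPair (ones a) y := by
  have hskip : ∀ r : List Bool,
      (argT.run .skip (ones n ++ false :: r)).2 = (argT.run .dbl r).2 := by
    intro r
    induction n with
    | zero => simp [FST.run_cons, argStep]
    | succ n ih => simpa [ones, List.replicate_succ, FST.run_cons, argStep] using ih
  simp only [FST.eval, argT, hdr]
  change [] ++ (if true then
    (argT.run .skip (ones n ++ false :: (ones a ++ false :: boolPair x y))).2 else []) = _
  rw [hskip, argT_run_dbl]
  simp

/-- The budget map `⟨x, y⟩ ↦ ⟨y, 1^{p |x|}⟩`: unary clock, argument transducer, swap.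
[Liu–Pass 2020, §2.2 (the input `(Π, 1^t)` of `U`)] [cite: LiuPass2020, §2.2] -/
noncomputable def budgetFn (p : Polynomial ℕ) : List Bool → List Bool :=
  swapFn ∘ argT.eval ∘ evalHdrFn p

/-- **`budgetFn p ⟨x, y⟩ = ⟨y, 1^{p |x|}⟩`.** [cite: LiuPass2020, §2.2] -/
theorem budgetFn_boolPair (p : Polynomial ℕ) (x y : List Bool) :
    budgetFn p (boolPair x y) = boolPair y (ones (p.eval x.length)) := by
  simp [budgetFn, evalHdrFn, argT_eval_hdr, swapFn_boolPair]

/-- `budgetFn p ∈ FP`. [Arora–Barak 2009, §1.3, §3.1] [cite: AroraBarakCC2009, §3.1] -/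
theorem budgetFn_mem_FP (p : Polynomial ℕ) : budgetFn p ∈ FP :=
  PolyTimeComputable.comp_holds swapFn_mem_FP
    (PolyTimeComputable.comp_holds argT.polyTimeComputable_eval (evalHdrFn_mem_FP p))

/-! #### The universal machine as a total string function -/

variable (U : UniversalMachine)

/-- **The universal machine as a total string function**:
`runFn U z = enc (U.run Π |u|)` for `(Π, u) = boolUnpair z`, where
`enc = (encodingList Bool).optionBool` (`none ↦ [0]`, `some w ↦ 1 w`); on a well-formed input
`⟨Π, 1^t⟩` this is `enc (U(Π, 1^t))` (`runFn_boolPair`). [Liu–Pass 2020, §2.2 (`U(Π, 1^t)` is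
computable in time `poly(|Π|, t)`)] [cite: LiuPass2020, §2.2] -/
def runFn (z : List Bool) : List Bool :=
  ((encodingList Bool).optionBool).encode (U.run (boolUnpair z).1 (boolUnpair z).2.length)

/-- **`runFn U ∈ FP`**: the machine of the field `UniversalMachine.polyTime` behind the
unary-argument normaliser of `PairPlumbing.lean` (`mem_FP_of_unaryArg`). [Liu–Pass 2020, §2.2]
[cite: LiuPass2020, §2.2] -/
theorem runFn_mem_FP : runFn U ∈ FP :=
  mem_FP_of_unaryArg U.polyTime

/-- On a well-formed input: `runFn U ⟨Π, 1^t⟩ = enc (U.run Π t)`. [cite: LiuPass2020, §2.2] -/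
theorem runFn_boolPair (prog : List Bool) (t : ℕ) :
    runFn U (boolPair prog (ones t)) = ((encodingList Bool).optionBool).encode (U.run prog t) := by
  simp [runFn]

/-- The execution map `⟨x, y⟩ ↦ enc (U.run y (p |x|))`. [Liu–Pass 2020, §2.2]
[cite: LiuPass2020, §2.2] -/
noncomputable def execFn (p : Polynomial ℕ) : List Bool → List Bool :=
  runFn U ∘ budgetFn p

/-- **`execFn U p ⟨x, y⟩ = enc (U.run y (p |x|))`.** [cite: LiuPass2020, §2.2] -/
theorem execFn_boolPair (p : Polynomial ℕ) (x y : List Bool) :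
    execFn U p (boolPair x y) =
      ((encodingList Bool).optionBool).encode (U.run y (p.eval x.length)) := by
  simp [execFn, budgetFn_boolPair, runFn_boolPair]

/-- `execFn U p ∈ FP`. [cite: LiuPass2020, §2.2] -/
theorem execFn_mem_FP (p : Polynomial ℕ) : execFn U p ∈ FP :=
  PolyTimeComputable.comp_holds (runFn_mem_FP U) (budgetFn_mem_FP p)

/-! #### The verifier -/

/-- The one-state transducer prefixing a `1`: `w ↦ 1 w`. [folklore] -/
def consTrueT : FST Unit Bool Bool where
  init := ()
  step := fun _ c => ((), [c])
  front := fun _ => [true]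
  keep := fun _ => true

/-- `consTrueT w = 1 w`. [folklore] -/
theorem consTrueT_eval (w : List Bool) : consTrueT.eval w = true :: w := by
  have h : ∀ w : List Bool, (consTrueT.run () w).2 = w := by
    intro w
    induction w with
    | nil => rfl
    | cons b w ih => simp [FST.run_cons, consTrueT, ih] at *
  simp [FST.eval, consTrueT, h] at *

/-- The tagging map `⟨x, y⟩ ↦ 1 x` (first projection, then `consTrueT`). [folklore] -/
def tagFstFn : List Bool → List Bool :=
  consTrueT.eval ∘ fun z => (boolUnpair z).1

/-- `tagFstFn ⟨x, y⟩ = 1 x`. [folklore] -/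
theorem tagFstFn_boolPair (x y : List Bool) : tagFstFn (boolPair x y) = true :: x := by
  simp [tagFstFn, consTrueT_eval]

/-- `tagFstFn ∈ FP`. [folklore] -/
theorem tagFstFn_mem_FP : tagFstFn ∈ FP :=
  PolyTimeComputable.comp_holds consTrueT.polyTimeComputable_eval boolUnpairFst_mem_FP

/-- **The verifier language** of `MK^tP`: the strings on which the execution result equals the
tagged first component, `{z | execFn U p z = tagFstFn z}`; on pairs, `⟨x, y⟩` is accepted iff
`enc (U.run y (p |x|)) = 1 x` (`boolPair_mem_verifierLang`). [Liu–Pass 2020, §2.2; Arora–Barak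
2009, Def. 2.1] [cite: LiuPass2020, §2.2] -/
def verifierLang (p : Polynomial ℕ) : Language Bool :=
  {z | execFn U p z = tagFstFn z}

/-- **`verifierLang U p ∈ P`**: an equality test of two `FP` maps
(`setOf_apply_eq_apply_mem_P`). [cite: LiuPass2020, §2.2] -/
theorem verifierLang_mem_P (p : Polynomial ℕ) : verifierLang U p ∈ P :=
  setOf_apply_eq_apply_mem_P (execFn_mem_FP U p) tagFstFn_mem_FP

/-- **The verifier accepts `⟨x, y⟩` iff `U(y, 1^{p|x|}) = x`.** [cite: LiuPass2020, §2.2] -/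
theorem boolPair_mem_verifierLang (p : Polynomial ℕ) (x y : List Bool) :
    boolPair x y ∈ verifierLang U p ↔ U.run y (p.eval x.length) = some x := by
  change execFn U p (boolPair x y) = tagFstFn (boolPair x y) ↔ _
  rw [execFn_boolPair, tagFstFn_boolPair]
  cases U.run y (p.eval x.length) with
  | none => simp [Computability.Encoding.optionBool]
  | some w => simp [Computability.Encoding.optionBool, encodingList]

end MKtimePNP

/-- `K^t(x) ≤ s` for a natural number `s` iff some program of length `≤ s` prints `x` within `t`
steps (the infimum over a nonempty set of naturals is attained). [Liu–Pass 2020, §2.2]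
[cite: LiuPass2020, §2.2] -/
theorem ktAt_le_coe_iff (U : UniversalMachine) {t s : ℕ} {x : List Bool} :
    U.ktAt t x ≤ s ↔ ∃ prog, U.run prog t = some x ∧ prog.length ≤ s := by
  constructor
  · intro h
    have hlt : U.ktAt t x < (s + 1 : ℕ) := h.trans_lt (by exact_mod_cast Nat.lt_succ_self s)
    obtain ⟨prog, hrun, hlen⟩ := U.exists_run_eq_of_ktAt_lt hlt
    exact ⟨prog, hrun, Nat.lt_succ_iff.1 (by exact_mod_cast hlen)⟩
  · rintro ⟨prog, hrun, hlen⟩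
    exact (U.ktAt_le_length hrun).trans (by exact_mod_cast hlen)

open MKtimePNP in
/-- **Sanity lemma `MK^tP[s] ∈ NP`, discharged**: for every efficient universal machine `U` and
all polynomials `t = p`, `s = q`, Liu–Pass's language `MK^tP[s] = {x | K^t(x) ≤ s(|x|)}` is in
`NP`. Certificate: a program `y` with `|y| ≤ q(|x|)`; `P`-language of pairs:
`MKtimePNP.verifierLang U p` ("run `U(y, 1^{p(|x|)})`, compare with `x`"), which is in `P`
because `U(Π, 1^t)` is computable in time `poly(|Π|, t)` (field `UniversalMachine.polyTime`)
and the comparison is a polynomial-time equality test (`setOf_apply_eq_apply_mem_P`).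
[Liu–Pass 2020, §2.2 (with Ko 1991); Hirahara FOCS 2018, §1 ("MINKT ∈ NP")]
[cite: LiuPass2020, §2.2] -/
theorem MKtimeP_mem_NP_holds : MKtimeP_mem_NP := by
  intro U p q
  refine ⟨verifierLang U p, verifierLang_mem_P U p, q, fun x => ?_⟩
  rw [UniversalMachine.mem_MKtimeP_iff, UniversalMachine.kt, ktAt_le_coe_iff]
  simp only [boolPair_mem_verifierLang]
  exact ⟨fun ⟨prog, hrun, hlen⟩ => ⟨prog, hlen, hrun⟩, fun ⟨y, hlen, hrun⟩ => ⟨y, hrun, hlen⟩⟩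

/-- Applied form of `MKtimeP_mem_NP_holds`, with the fact unfolded. [cite: LiuPass2020, §2.2] -/
theorem MKtimeP_mem_NP' (U : UniversalMachine) (p q : Polynomial ℕ) :
    U.MKtimeP (fun n => p.eval n) (fun n => q.eval n) ∈ NP :=
  MKtimeP_mem_NP_holds U p q

end Literature.Computability.Cryptography
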